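import Literature.MathematicalPhysics.QuantumFieldTheory.Balaban1983to89.B9Eq316AveragingTransposeZd
import Literature.MathematicalPhysics.QuantumFieldTheory.Balaban1983to89.B9SupplySockB9P3ZdGamma

/-!
# `Balaban1983to89.B9Eq316AveragingTransposeZdPrinted` — [Balaban1985BackgroundPropagators] (3.16) p. 393, companion of
# `B9Eq316AveragingTransposeZd` (the genuine averaging letter `Q*aQ` on the `ℤᵈ × 𝔸` carrier): (§2) THE GENUINENESS CERTIFICATE — the summed pairing
# identity `Σ_b ⟨(Q_jᵀB)(b), A(b)⟩_τ = Σ_c ⟨B(c), (LʲQ_j(U₀)A)(c)⟩_τ` (the fibre-transposed composite averaging IS the transpose) —, and (§3) EDITION P: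
# the letter and its binders `AvgAtP` (univ road) ∕ `AvgAtγ` (cube road, §4) at PRINT'S box law «box ⊂ Ω_{j−1}» of [Balaban1985RegularSpaces] (1.31)
# (crossing bonds), the class the `Ω₀ = ℤᵈ` road's `towerBondsP` and the cube road's `cubeLamBP'` actually carry

statement-level skeleton of published theorems with citation tags; proofs where landed; nothing here is a claim about the
Yang–Mills mass gap

`[Balaban1985BackgroundPropagators]` ("B9", CMP **99** (1985) 389–434) p. 393 (3.16) *«⟨A, Q*aQA⟩ = Σ_{j=0}^{k} a Σ_{b∈Λ_j} (Lʲη)^{d−2}|(Q_j(U)A)(b)|²»*,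
(3.17) (the weights `η^d`), (3.26) p. 395; `[Balaban1985RegularSpaces]` ("B8", CMP **99** (1985) 75–102) (1.31) p. 82 (inner bonds «⟨x, x′⟩ ⊂ Λ_j» AND
crossing bonds «b₋ ∈ Λ_j, Γ_{b₋,x} ⊂ Λ_{j−1}» — the latter's contour runs in `Λ_{j−1} ⊂ Ω_{j−1}`), (1.7) p. 77, (1.56)∕(1.58) p. 86; `[Balaban1985Averaging]`
("B7" = B9's [5]) (127) p. 37, p. 24 (locality), (141) p. 39, (147) p. 40, Prop. 5 p. 42.  Pages re-read by this seat on the held text layers (2026-08-28).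

CITATION HEADER (lean-in-tree rule).  Cell `pub-ymgap` (YM Track A, D-0062 ∕ D-0149), DAG node N06 = [B9], seat `pub-ymgap-dag-n06-b` gen 17 (binder owner
of the J-N06→N05 junction), the hour after `B9Eq316AveragingTransposeZd` (p595278) landed.  WHY A COMPANION (LOCATED-SELF, before any consumer): (a) the
v1.0 file states that `entryT`∕`linCovIterT` ARE transposes but types only the column-level certificate (`tauForm_entryT` + `column_linear_of_reg17`); the
SUMMED identity over finitely supported fields is typed here (§2); (b) v1.0's class law `LevelSepP` asks «box ⊂ Ω_j» of EVERY level-`j` class bond — true for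
the typed classes `towerBonds`∕`cubeLamB`, FALSE for print's class at the CROSSING bonds of (1.31), whose box lies in `Ω_{j−1}` only
(`B8TowerBondsPrinted.towerBondsP_box_subset_pred`, `B8Ineq159FlatCubeMemberPrinted.cubeLamBP_box_subset_pred`) — so at `towerBondsP`∕`cubeLamBP'`
members with crossing bonds v1.0's `avgAtP_withQQ` does not apply; EDITION P (§3) is the same letter with the regime window `α_Q∕L²` — the class (1.7) at
that window, read one level up (`reg17_shift`: `|U(∂p) − 1| < (α_Q∕L²)L^{−2(j−1)} = α_Q L^{−2j}` on `Ω_{j−1}`), is exactly the window `α_Q` that [5] Prop. 5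
(147) needs on boxes `⊂ Ω_{j−1}` — and its binder theorem `avgAtP_withQQP` under `LevelSepPP` («box ⊂ Ω_{j−1}» + the collar clause).  REUSED BY NAME:
everything public of `B9Eq316AveragingTransposeZd` (`tauForm`, `entryT`, `tauForm_entryT`, `linCovIterT`, `norm_linCovIterT_le`, `winBase`, `inBox_winBase`,
`alphaQ` + windows, `Reg17` + `reg17_of_inAk ∕ _mono`, `norm_linCovIter_bump_le_of_reg17`, `norm_linCovIter_le_of_reg17`, `wQ`, `clsField`, `qQ`, `betaTau`,
`LevelSepP`, `column_linear_of_reg17`); its PRIVATE plumbing (`clamp_data`, `linCovIter_congr`, …) is re-copied privately (same statements).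

WHAT IS DECLARED ∕ PROVED (kernel, 0 sorry; definitions WITH BODY + theorems; no `instance`, no `notation`, no `def … : Prop` hypothesis taken).
* §2 `eq_winBase_of_inBox` (a level-`j` bond whose box contains `y` IS a window bond of `y`: the window of `linCovIterT` is exact) · ★★ `tauForm_linCovIterT_pair`
  — THE SUMMED PAIRING IDENTITY: unitary `U₀ ∈ Reg17` (`α ≤ α_Q`), `j ≤ m`, `T` a finite set of level-`j` bonds with boxes in `Ω_j`, `B` supported in `T`, `A`
  supported in a finite `S`, faithful `τ` ⇒ `Σ_{b∈S} ⟨(Q_jᵀB)(b), A(b)⟩_τ = Σ_{c∈T} ⟨B(c), (LʲQ_j(U₀)A)(c)⟩_τ` (column linearity + `tauForm_entryT`, the exact window +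
  the locality clause of `prop5_general_147` at the clamped background, `linCovIter_family` over the support of `A`, Fubini) — so the letter's level-`j`
  summand is print's `(Lʲη)⁻²Q*_jΛ_jQ_j` in the pairing (3.16)–(3.17) (`Q*_j = L^{jd}Q_jᵀ`); at boxes `⊂ Ω_{j−1}` apply it to the shifted data of `reg17_shift`.
* §3 EDITION P: `reg17_shift` · ★★ `QQZdP τ L ΛbP i m` (def: `QQZd` VERBATIM with window `α_Q∕L²`) · `withQQP` (+ `withQQP_QQ∕_Gop∕_Dp∕_DRDs`) ·
  `QQZdP_of_reg17 ∕ _of_not_reg17 ∕ _of_inAk` (the letter is the genuine sum at every socket datum `U₀ ∈ 𝔄_k({Ω_j}, α₀)`, `α₀ ≤ α_Q∕L²`) · `LevelSepPP L m Ω ΛbP s`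
  (def: every site of the box of a level-`j` class bond lies in `Ω_{j−1}`, and a unit bond there touches `Ω_i` only for `i ≤ j + s`) · `levelSepPP_of_levelSepP` ·
  ★★★ `avgAtP_withQQP` : `B9SupplySockB9P3ZdGammaUniv.AvgAtP L (withQQP τ L ΛbP ops₀) (qQ d L C_τ β_τ s) ΛbP M i m` for every `M`, member `i`, `m`, `ops₀`, every
  class with `LevelSepPP L m i.Ω ΛbP s` (`d ≥ 2`, `L ≥ 2`, `𝔸` finite-dimensional over `ℝ`, `|Re τ(x*y)| ≤ C_τ‖x‖‖y‖`) — v1.0's proof VERBATIM with the two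
  (147) inputs read at the shifted class · ★★ `avgAt_withQQP` (`ΛbP := i.Λb`) · A6 ★ `avgAtP_withQQP_complex` (`𝔸 = ℂ`, `τ = id`).

HONEST SCOPE.  As the companion's: ONE letter (`QQ`) as an object + ONE binder (`AvgAtP`∕`AvgAt`) proved; `Gop` (Thm 3.11 + 3.3) untouched; the letter is
print's `Q*aQ` ON the class (1.7) at `α_Q∕L²` (every socket datum with `α₀ ≤ α_Q∕L²`), `0` off it; the class law `LevelSepPP` is DISPLAYED — its box
clause is the law owners' `towerBondsP_box_subset_pred` ∕ `cubeLamBP_box_subset_pred` BY NAME, its collar clause (`i ≤ j + s`) is print's (1.28)∕[B6]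
(2.2) separation and is NOT among the typed `ZdIdx` laws (nested-but-equal domains violate it): to be supplied by the law owners ∕ as an index-map
hypothesis; count-neutral helper of K1⁷; N05∕N06 NOT discharged; nothing continuum ∕ `ℝ⁴` ∕ OS ∕ mass-gap ∕ Clay.  Unit `pub-ymgap-dag-n06-b` (g17), 2026-08-28.
-/

noncomputable section

open scoped BigOperators
open NormedSpace

namespace Literature.MathematicalPhysics.QuantumFieldTheory.Balaban1983to89.B9Eq316AveragingTransposeZdPrinted

open B9Eq316AveragingTransposeZd

-- `Site` alone could resolve to the torus sites of `Setup.lean`; re-export the `ℤ^d` sites of `B7Prop1Explicit`.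
export B7Prop1Explicit (Site)

variable {d : ℕ} {𝔸 : Type*} [CStarAlgebra 𝔸]

/-! ## §1 Private plumbing re-copied from the companion (same statements; private there) -/

section Plumbing

open B7Prop1Explicit (U1 e)
open B7Prop1Local (InBox AgreeOn PlaqIn loK bondHiK bondHi clampCfg clampCfg_agree clampCfg_mem pdev_clampCfg_le avgIter_congr
  add_e_apply)
open B7Prop2Explicit (pdev AvgClosed C0 c2' C0_pos c2'_pos avgIter unitaryUnits avgClosed_unitaryUnits)
open B7Prop5Flat (BondIn bump bondsIn restr insCfg_restr_of_mem mem_bondsIn agreeOn_insCfg_restr inBox_nest boxFinset mem_boxFinset)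
open B7Prop3Flat (insCfg)
open B7Prop3GeneralLinear (Qcov linQcov)
open B7Prop4GeneralLevels (logCovIter linCovIter linCovIter_succ linCovIter_zero)
open B7LocalityGeneral (Qcov_congr)
open B8Ineq132 (plaqF pdevOn_lt_of_forall CondAt InAk PlaqTouches BondTouches)

variable (τ : 𝔸 →ₗ[ℂ] ℂ)

section F
variable [FiniteDimensional ℝ 𝔸]
/-- `Eᵀ` of the zero vector is `0`. [folklore] -/
private theorem entryT_zero (E : 𝔸 → 𝔸) : entryT τ E 0 = 0 := by
  unfold entryT
  split_ifs
  · simp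
  · rfl

/-- `β_τ ≥ 0`. [folklore] -/
private theorem betaTau_nonneg : 0 ≤ betaTau τ := by
  unfold betaTau
  split_ifs
  · exact Finset.sum_nonneg fun i _ => mul_nonneg (norm_nonneg _) (norm_nonneg _)
  · exact le_rfl

end F

variable [Nontrivial 𝔸]

omit [Nontrivial 𝔸] in
/-- **Locality of the one-step linear part (122)** jointly in `(V₀, A)` (private copy of the lineage's lemma — public twins on the Summits side
and in `B8Eq156KLevelLocal`, private there). [cite: Balaban1985Averaging, (122) p.36, p.24] -/
private theorem linQcov_congr (L : ℕ) (hL : 1 ≤ L) (q : Site d) (κ : Fin d) {V₀ V₀' : Site d → Fin d → 𝔸ˣ}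
    {A A' : Site d → Fin d → 𝔸} (h₀ : AgreeOn q (bondHi L q κ) V₀ V₀') (hA : AgreeOn q (bondHi L q κ) A A') :
    linQcov L V₀ A q κ = linQcov L V₀' A' q κ := by
  unfold linQcov
  congr 1
  funext t
  exact Qcov_congr L hL q κ h₀ fun x μ hx hxe => by
    show t • A x μ = t • A' x μ
    rw [hA x μ hx hxe]

omit [Nontrivial 𝔸] in
/-- **Locality of the composite linear averaging `LʲηQ_jA(c)`** in the bonds of `Bʲ(c₋) ∪ Bʲ(c₊)`, jointly in `(U₀, A)` (private copy).
[cite: Balaban1985Averaging, p.24 (after (43)), p.38 (before (133))] -/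
private theorem linCovIter_congr (L : ℕ) (hL : 1 ≤ L) :
    ∀ (j : ℕ) {U₀ U₀' : Site d → Fin d → 𝔸ˣ} {B B' : Site d → Fin d → 𝔸} (z : Site d) (κ : Fin d),
      AgreeOn (loK L j z) (bondHiK L j z κ) U₀ U₀' → AgreeOn (loK L j z) (bondHiK L j z κ) B B' →
        linCovIter L U₀ B j z κ = linCovIter L U₀' B' j z κ
  | 0, U₀, U₀', B, B', z, κ, _, h => by
    refine h z κ (fun i => ?_) (fun i => ?_)
    · simp only [loK, bondHiK, pow_zero, one_mul]; split_ifs <;> omega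
    · simp only [loK, bondHiK, pow_zero, one_mul, add_e_apply]; split_ifs <;> omega
  | j + 1, U₀, U₀', B, B', z, κ, h₀, h => by
    rw [linCovIter_succ, linCovIter_succ]
    refine linQcov_congr L hL _ κ (fun x μ hx hxe => ?_) (fun x μ hx hxe => ?_)
    · exact avgIter_congr L hL j x μ fun p ν hp hpν =>
        h₀ p ν (inBox_nest L j z κ ⟨hx, hxe⟩ hp) (inBox_nest L j z κ ⟨hx, hxe⟩ hpν)
    · exact linCovIter_congr L hL j x μ
        (fun p ν hp hpν => h₀ p ν (inBox_nest L j z κ ⟨hx, hxe⟩ hp) (inBox_nest L j z κ ⟨hx, hxe⟩ hpν))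
        (fun p ν hp hpν => h p ν (inBox_nest L j z κ ⟨hx, hxe⟩ hp) (inBox_nest L j z κ ⟨hx, hxe⟩ hpν))

omit [CStarAlgebra 𝔸] [Nontrivial 𝔸] in
/-- the box is a genuine box: `loK ≤ bondHiK` coordinatewise (`L ≥ 1`). [folklore] -/
private theorem loK_le_bondHiK {L : ℕ} (hL : 1 ≤ L) (j : ℕ) (z : Site d) (κ : Fin d) (i : Fin d) :
    loK L j z i ≤ bondHiK L j z κ i := by
  have hP : (1 : ℤ) ≤ (L : ℤ) ^ j := one_le_pow₀ (by exact_mod_cast hL)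
  simp only [loK, bondHiK]
  split_ifs <;> omega

/-- the clamped extension `π^*U₀` of a configuration in the class (1.7) at a bond of the `j`-lattice whose box lies in `Ω_j` is GLOBALLY
`αL^{−2j}`-regular, unitary, and agrees with `U₀` on the box (`B7Prop1Local.clampCfg`, the `B8Eq156KLevelLocal.eq156_loc` device).
[cite: Balaban1985Averaging, p.24 (locality), Prop. 1 (51) p.26; Balaban1985RegularSpaces, (1.7) p.77] -/
private theorem clamp_data {L : ℕ} (hL : 1 ≤ L) {m : ℕ} {Ω : ℕ → Set (Site d)} {α : ℝ} (hα : 0 < α)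
    {U₀ : Site d → Fin d → 𝔸ˣ} (hU₀ : ∀ x κ, U₀ x κ ∈ unitaryUnits 𝔸) (hreg : Reg17 L m Ω α U₀)
    {j : ℕ} (hj : j ≤ m) (z : Site d) (κ : Fin d) (hbox : ∀ x, InBox (loK L j z) (bondHiK L j z κ) x → x ∈ Ω j) :
    (∀ x ν, clampCfg (loK L j z) (bondHiK L j z κ) U₀ x ν ∈ unitaryUnits 𝔸) ∧
      pdev (clampCfg (loK L j z) (bondHiK L j z κ) U₀) < α * (((L : ℝ) ^ j)⁻¹) ^ 2 ∧
      AgreeOn (loK L j z) (bondHiK L j z κ) (clampCfg (loK L j z) (bondHiK L j z κ) U₀) U₀ := by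
  have hU₀U1 : ∀ x μ, U₀ x μ ∈ U1 𝔸 := fun x μ => (avgClosed_unitaryUnits d L).le_U1 (hU₀ x μ)
  have hL0 : (0 : ℝ) < L := by exact_mod_cast hL
  refine ⟨clampCfg_mem hU₀, ?_, clampCfg_agree U₀⟩
  have hpdOn : B7Prop1Local.pdevOn (loK L j z) (bondHiK L j z κ) U₀ < α * (((L : ℝ) ^ j)⁻¹) ^ 2 := by
    refine pdevOn_lt_of_forall (by positivity) fun x μ ν hx hx' => ?_
    rcases eq_or_ne μ ν with rfl | hμν
    · rw [B7Prop2Explicit.hol_plaqWord_self, Units.val_one, sub_self, norm_zero]; positivity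
    · exact hreg j hj x μ ν hμν (Or.inl (hbox x hx))
  exact (pdev_clampCfg_le (loK_le_bondHiK hL j z κ) hU₀U1).trans_lt hpdOn

omit [Nontrivial 𝔸] in
/-- `LʲηQ_j(U₀)0 = 0` (every one-step linear part is a derivative of a constant). [cite: Balaban1985Averaging, (127) p.37] -/
private theorem linCovIter_zero_fun (L : ℕ) (U₀ : Site d → Fin d → 𝔸ˣ) : ∀ j : ℕ, linCovIter L U₀ (0 : Site d → Fin d → 𝔸) j = 0
  | 0 => rfl
  | j + 1 => by
    funext z κ
    rw [linCovIter_succ, linCovIter_zero_fun L U₀ j]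
    simp [linQcov]

omit [Nontrivial 𝔸] in
/-- the restriction of a bond field to a finite bond set is the finite sum of its single-bond pieces. [folklore] -/
private theorem insCfg_restr_eq_sum (S : Finset (Site d × Fin d)) (B : Site d → Fin d → 𝔸) :
    insCfg S (restr S B) = (0 : Site d → Fin d → 𝔸) + ∑ s ∈ S, (1 : ℂ) • bump s.1 s.2 (B s.1 s.2) := by
  classical
  funext x κ
  rw [zero_add, Finset.sum_apply, Finset.sum_apply]
  simp only [Pi.smul_apply, one_smul, bump, insCfg, restr]
  by_cases h : (x, κ) ∈ S
  · rw [dif_pos h, Finset.sum_eq_single (x, κ)]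
    · simp
    · rintro ⟨x', κ'⟩ _ hne
      rw [if_neg]
      rintro ⟨rfl, rfl⟩
      exact hne rfl
    · intro hn; exact absurd h hn
  · rw [dif_neg h]
    symm
    refine Finset.sum_eq_zero fun s hs => ?_
    rw [if_neg]
    rintro ⟨rfl, rfl⟩
    exact h hs


end Plumbing

section MorePlumbing

open B7Prop5GeneralLevels (thetaGen)

variable [FiniteDimensional ℝ 𝔸] (L : ℕ)

omit [FiniteDimensional ℝ 𝔸] in
/-- `w_j ≥ 0`. [folklore] -/
private theorem wQ_nonneg {η : ℝ} (hη : 0 ≤ η) (j : ℕ) : 0 ≤ wQ (d := d) L η j := by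
  unfold wQ; positivity

omit [CStarAlgebra 𝔸] [FiniteDimensional ℝ 𝔸] in
/-- in dimension `d ≥ 2` every direction has another one. [folklore] -/
private theorem exists_ne_dir (hd : 2 ≤ d) (μ : Fin d) : ∃ κ : Fin d, κ ≠ μ := by
  by_cases h : (μ : ℕ) = 0
  · exact ⟨⟨1, by omega⟩, fun hk => by have := congrArg Fin.val hk; simp at this; omega⟩
  · exact ⟨⟨0, by omega⟩, fun hk => by have := congrArg Fin.val hk; simp at this; omega⟩

omit [CStarAlgebra 𝔸] [FiniteDimensional ℝ 𝔸] in
/-- the finite geometric bound behind the `m`-uniformity of `q`: `Σ_{j ≤ m, j₀ ≤ j+s} (L³)^s·(L⁻³)^{j+s−j₀} ≤ 2(L³)^s` (`L ≥ 2`). [folklore] -/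
private theorem level_sum_le {L : ℕ} (hL : 2 ≤ L) (m j₀ s : ℕ) :
    ∑ j ∈ Finset.range (m + 1),
        (if j₀ ≤ j + s then ((L : ℝ) ^ 3) ^ s * (((L : ℝ) ^ 3)⁻¹) ^ (j + s - j₀) else 0)
      ≤ 2 * ((L : ℝ) ^ 3) ^ s := by
  classical
  have hL' : (2 : ℝ) ≤ L := by exact_mod_cast hL
  set r : ℝ := ((L : ℝ) ^ 3)⁻¹ with hr
  have hL3 : (8 : ℝ) ≤ (L : ℝ) ^ 3 := by
    have h := pow_le_pow_left₀ (by norm_num : (0 : ℝ) ≤ 2) hL' 3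
    norm_num at h
    exact h
  have hr0 : 0 ≤ r := by rw [hr]; positivity
  have hr1 : r ≤ 1 / 2 := by
    rw [hr, inv_le_comm₀ (by positivity) (by norm_num)]
    linarith
  have hP : 0 ≤ ((L : ℝ) ^ 3) ^ s := by positivity
  -- restrict to the levels that count and re-index by `n = j + s − j₀`
  set S := (Finset.range (m + 1)).filter (fun j => j₀ ≤ j + s) with hS
  have hsum : ∑ j ∈ Finset.range (m + 1),
        (if j₀ ≤ j + s then ((L : ℝ) ^ 3) ^ s * r ^ (j + s - j₀) else 0)
      = ((L : ℝ) ^ 3) ^ s * ∑ j ∈ S, r ^ (j + s - j₀) := by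
    rw [hS, Finset.sum_filter, Finset.mul_sum]
    refine Finset.sum_congr rfl fun j _ => ?_
    split_ifs <;> simp
  rw [hsum, mul_comm (2 : ℝ)]
  refine mul_le_mul_of_nonneg_left ?_ hP
  -- `j ↦ j + s − j₀` is injective on `S`, with values `< m + 1 + s`
  have hinj : Set.InjOn (fun j => j + s - j₀) (S : Set ℕ) := by
    intro a ha b hb hab
    simp only [hS, Finset.coe_filter, Finset.mem_range, Set.mem_setOf_eq] at ha hb
    simp only at hab
    omega
  calc ∑ j ∈ S, r ^ (j + s - j₀) = ∑ n ∈ S.image (fun j => j + s - j₀), r ^ n := (Finset.sum_image hinj).symm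
    _ ≤ ∑ n ∈ Finset.range (m + 1 + s), r ^ n := by
        refine Finset.sum_le_sum_of_subset_of_nonneg (fun n hn => ?_) (fun n _ _ => by positivity)
        simp only [Finset.mem_image, hS, Finset.mem_filter, Finset.mem_range] at hn
        obtain ⟨j, ⟨hj, hj'⟩, rfl⟩ := hn
        simp only [Finset.mem_range]
        omega
    _ = ∑ n ∈ Finset.Ico 0 (m + 1 + s), r ^ n := by rw [Finset.range_eq_Ico]
    _ ≤ r ^ 0 / (1 - r) := geom_sum_Ico_le_of_lt_one hr0 (by linarith)
    _ ≤ 2 := by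
        rw [pow_zero, div_le_iff₀ (by linarith)]
        linarith

end MorePlumbing

section CplxPriv
/-- the identity functional on `ℂ` obeys `|Re (x̄·y)| ≤ ‖x‖‖y‖`. [folklore] -/
private theorem abs_re_star_mul_le_complex (x y : ℂ) :
    |((LinearMap.id : ℂ →ₗ[ℂ] ℂ) (star x * y)).re| ≤ 1 * ‖x‖ * ‖y‖ := by
  rw [LinearMap.id_apply, one_mul]
  calc |(star x * y).re| ≤ ‖star x * y‖ := Complex.abs_re_le_norm _
    _ = ‖x‖ * ‖y‖ := by rw [norm_mul, norm_star]

end CplxPriv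

/-! ## §2 The window is exact and the summed pairing identity — `linCovIterT` IS the `⟨·,·⟩_τ`-transpose of `LʲQ_j(U₀)` -/

section Pairing

open B7Prop1Explicit (e)
open B7Prop1Local (InBox loK bondHiK add_e_apply clampCfg)
open B7Prop2Explicit (unitaryUnits avgClosed_unitaryUnits C0 c2' C0_pos)
open B7Prop3Flat (insCfg)
open B7Prop5Flat (BondIn bump restr insCfg_restr_of_mem)
open B7Prop4GeneralLevels (linCovIter)
open B7Prop5GeneralLevels (thetaGen hadd_levels hsmul_levels h139_levels)
open B7Prop5GeneralLinear (linCovIter_line linCovIter_bump_eq_zero)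
open B7Prop5General (prop5_general_147)
open B7Prop5LineDerivFiniteFamily (linCovIter_family)

/-- Euclidean division: `a div P = w ↔ Pw ≦ a < Pw + P` (`P > 0`) (private copy). [folklore] -/
private theorem ediv_eq_iff_of_pos {P : ℤ} (hP : 0 < P) {a w : ℤ} : a / P = w ↔ P * w ≤ a ∧ a < P * w + P := by
  rw [le_antisymm_iff, ← Int.lt_add_one_iff, Int.ediv_lt_iff_lt_mul hP, Int.le_ediv_iff_mul_le hP]
  have h1 : (w + 1) * P = P * w + P := by ring
  have h2 : w * P = P * w := mul_comm _ _
  rw [h1, h2]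
  exact and_comm

omit [CStarAlgebra 𝔸] in
/-- **THE WINDOW IS EXACT**: a level-`j` bond `c = ⟨x, x + e_κ⟩` whose box contains the site `y` IS a window bond of `y`: `x = winBase L j y κ t`
for `t = 0` or `1` (`L ≥ 1`). [cite: Balaban1985Averaging, p.24 (after (43))] -/
theorem eq_winBase_of_inBox {L : ℕ} (hL : 1 ≤ L) (j : ℕ) {x y : Site d} {κ : Fin d}
    (h : InBox (loK L j x) (bondHiK L j x κ) y) : ∃ t : Fin 2, x = winBase L j y κ t := by
  have hP : (0 : ℤ) < (L : ℤ) ^ j := by positivity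
  -- off the direction `κ`: `x_i = y_i ∕ Lʲ`; along `κ`: `y_κ ∕ Lʲ − x_κ ∈ {0, 1}`
  have hoff : ∀ i, i ≠ κ → y i / (L : ℤ) ^ j = x i := by
    intro i hi
    have h1 : (L : ℤ) ^ j * x i ≤ y i := by have := (h i).1; simpa [loK] using this
    have h2 : y i ≤ (L : ℤ) ^ j * x i + ((L : ℤ) ^ j - 1) := by
      have := (h i).2; simpa [bondHiK, hi] using this
    rw [ediv_eq_iff_of_pos hP]; constructor <;> linarith
  have hκ : y κ / (L : ℤ) ^ j = x κ ∨ y κ / (L : ℤ) ^ j = x κ + 1 := by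
    have h1 : (L : ℤ) ^ j * x κ ≤ y κ := by have := (h κ).1; simpa [loK] using this
    have h2 : y κ ≤ (L : ℤ) ^ j * x κ + ((L : ℤ) ^ j - 1) + (L : ℤ) ^ j := by
      have := (h κ).2; simpa [bondHiK] using this
    have hring : (L : ℤ) ^ j * (x κ + 1) = (L : ℤ) ^ j * x κ + (L : ℤ) ^ j := by ring
    by_cases hlt : y κ < (L : ℤ) ^ j * x κ + (L : ℤ) ^ j
    · left; rw [ediv_eq_iff_of_pos hP]; constructor <;> linarith
    · right; rw [ediv_eq_iff_of_pos hP, hring]; constructor <;> linarith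
  rcases hκ with h0 | h1
  · refine ⟨0, funext fun i => ?_⟩
    by_cases hi : i = κ
    · subst hi; simp [winBase, h0]
    · simp [winBase, hi, hoff i hi]
  · refine ⟨1, funext fun i => ?_⟩
    by_cases hi : i = κ
    · subst hi; simp [winBase, h1]
    · simp [winBase, hi, hoff i hi]


omit [CStarAlgebra 𝔸] in
/-- the window map `(κ, t) ↦ (winBase L j y κ t, κ)` is injective. [folklore] -/
private theorem winBase_injective (L j : ℕ) (y : Site d) :
    Function.Injective (fun p : Fin d × Fin 2 => (winBase L j y p.1 p.2, p.1)) := by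
  rintro ⟨κ, t⟩ ⟨κ', t'⟩ h
  simp only [Prod.mk.injEq] at h
  obtain ⟨hx, rfl⟩ := h
  have h := congr_fun hx κ
  dsimp only [winBase] at h
  rw [if_pos rfl, if_pos rfl] at h
  have ht : ((t : ℕ) : ℤ) = ((t' : ℕ) : ℤ) := by linarith
  refine Prod.ext rfl (Fin.ext ?_)
  exact_mod_cast ht

/-- a field vanishing off a finite bond set is the insertion of its restriction. [folklore] -/
private theorem eq_insCfg_restr_of_support (S : Finset (Site d × Fin d)) {A : Site d → Fin d → 𝔸}
    (hA : ∀ b : Site d × Fin d, b ∉ S → A b.1 b.2 = 0) : A = insCfg S (restr S A) := by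
  funext x κ
  by_cases h : (x, κ) ∈ S
  · rw [insCfg_restr_of_mem _ _ h]
  · rw [hA (x, κ) h]; simp [insCfg, h]

variable (τ : 𝔸 →ₗ[ℂ] ℂ) [FiniteDimensional ℝ 𝔸]

set_option maxHeartbeats 400000 in
/-- ★★ **THE SUMMED PAIRING IDENTITY — `linCovIterT` IS THE `⟨·,·⟩_τ`-TRANSPOSE OF THE COMPOSITE AVERAGING**: for a unitary `U₀` in the class (1.7)
(`α ≤ α_Q`), a level `j ≤ m`, a finite set `T` of level-`j` bonds whose boxes lie in `Ω_j` (class bonds), a bond field `B` supported in `T` and a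
unit-lattice bond field `A` supported in a finite set `S`:
`Σ_{b ∈ S} ⟨(Q_jᵀB)(b), A(b)⟩_τ = Σ_{c ∈ T} ⟨B(c), (LʲQ_j(U₀)A)(c)⟩_τ` — so `QQZd`'s level-`j` summand is print's `(Lʲη)⁻²Q*_jΛ_jQ_j` in the pairing of
(3.16)–(3.17) (`Q*_j = L^{jd}Q_jᵀ` for the level weights).  Ingredients: column linearity (§5b) + `tauForm_entryT` (faithful `τ`), the exact window
(`eq_winBase_of_inBox`) + locality (the column vanishes unless `b ⊂ Bʲ(c₋) ∪ Bʲ(c₊)`, [5] (141)∕(147)), and additivity of the composite over the finite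
support of `A`. [cite: Balaban1985BackgroundPropagators, (3.16)–(3.17) p.393; Balaban1985Averaging, (127) p.37, (141) p.39, (147) p.40, p.24] -/
theorem tauForm_linCovIterT_pair [Nontrivial 𝔸] {L : ℕ} (hL : 2 ≤ L) (hτp : ∀ a : 𝔸, a ≠ 0 → 0 < (τ (star a * a)).re)
    {m : ℕ} {Ω : ℕ → Set (Site d)} {α : ℝ} (hα : 0 < α) (hαQ : α ≤ alphaQ d L)
    {U₀ : Site d → Fin d → 𝔸ˣ} (hU₀ : ∀ x κ, U₀ x κ ∈ unitaryUnits 𝔸) (hreg : Reg17 L m Ω α U₀) {j : ℕ} (hj : j ≤ m)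
    (T : Finset (Site d × Fin d)) (hT : ∀ c ∈ T, ∀ x, InBox (loK L j c.1) (bondHiK L j c.1 c.2) x → x ∈ Ω j)
    (B : Site d → Fin d → 𝔸) (hB : ∀ c : Site d × Fin d, c ∉ T → B c.1 c.2 = 0)
    (S : Finset (Site d × Fin d)) (A : Site d → Fin d → 𝔸) (hA : ∀ b : Site d × Fin d, b ∉ S → A b.1 b.2 = 0) :
    ∑ b ∈ S, tauForm τ (linCovIterT τ L U₀ j B b.1 b.2) (A b.1 b.2) =
      ∑ c ∈ T, tauForm τ (B c.1 c.2) (linCovIter L U₀ A j c.1 c.2) := by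
  classical
  have hL1 : 1 ≤ L := le_trans (by norm_num) hL
  have hα3 : C0 d * α ≤ 1 / 3 := (mul_le_mul_of_nonneg_left hαQ (C0_pos d).le).trans (C0_mul_alphaQ_le d L)
  have hα4 : 4 * α ≤ c2' d L := by linarith [four_mul_alphaQ_le d L]
  have h145 : 8 * d * thetaGen d L α * (L : ℝ)⁻¹ ^ 4 ≤ 1 := by
    refine le_trans ?_ (h145_alphaQ d hL1)
    have : thetaGen d L α ≤ thetaGen d L (alphaQ d L) := by
      unfold thetaGen; exact mul_le_mul_of_nonneg_left hαQ (by positivity)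
    have hd : (0 : ℝ) ≤ d := Nat.cast_nonneg d
    exact mul_le_mul_of_nonneg_right (mul_le_mul_of_nonneg_left this (by positivity)) (by positivity)
  -- the column at `(c, b)`
  set col : (Site d × Fin d) → (Site d × Fin d) → 𝔸 → 𝔸 :=
    fun c b X => linCovIter L U₀ (bump b.1 b.2 X) j c.1 c.2 with hcol
  -- (a) at a CLASS bond the column is linear, local, and the composite is additive over finite families
  have hclass : ∀ c ∈ T,
      (∀ b X X', col c b (X + X') = col c b X + col c b X') ∧ (∀ b (r : ℝ) X, col c b (r • X) = r • col c b X) ∧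
      (∀ b X, ¬ BondIn (loK L j c.1) (bondHiK L j c.1 c.2) b.1 b.2 → col c b X = 0) ∧
      linCovIter L U₀ A j c.1 c.2 = ∑ b ∈ S, col c b (A b.1 b.2) := by
    intro c hc
    obtain ⟨hUG, hpdev, hag⟩ := clamp_data hL1 hα hU₀ hreg hj c.1 c.2 (hT c hc)
    set U' := clampCfg (loK L j c.1) (bondHiK L j c.1 c.2) U₀ with hU'
    have htr : ∀ B' : Site d → Fin d → 𝔸, linCovIter L U₀ B' j c.1 c.2 = linCovIter L U' B' j c.1 c.2 :=
      fun B' => linCovIter_congr L hL1 j c.1 c.2 hag.symm (fun _ _ _ _ => rfl)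
    have hlin := column_linear_of_reg17 hL hα hαQ hU₀ hreg hj c.1 c.2 (hT c hc)
    refine ⟨fun b X X' => (hlin b.1 b.2).1 X X', fun b r X => (hlin b.1 b.2).2 r X, fun b X hnot => ?_, ?_⟩
    · show linCovIter L U₀ (bump b.1 b.2 X) j c.1 c.2 = 0
      rw [htr]
      exact (prop5_general_147 L hL (avgClosed_unitaryUnits d L) j U' hUG hα hα3 hα4 hpdev h145 b.1 b.2 X le_rfl c.1 c.2).2 hnot
    · have hAeq := eq_insCfg_restr_of_support S hA
      calc linCovIter L U₀ A j c.1 c.2 = linCovIter L U' (insCfg S (restr S A)) j c.1 c.2 := by rw [htr, ← hAeq]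
        _ = linCovIter L U' ((0 : Site d → Fin d → 𝔸) + ∑ s ∈ S, (1 : ℂ) • bump s.1 s.2 (A s.1 s.2)) j c.1 c.2 := by
            rw [insCfg_restr_eq_sum]
        _ = ∑ s ∈ S, (1 : ℂ) • linCovIter L U' (bump s.1 s.2 (A s.1 s.2)) j c.1 c.2 := by
            rw [linCovIter_family L U' j (hadd_levels L hL (avgClosed_unitaryUnits d L) j U' hUG hα hα3 hα4 hpdev)
                (hsmul_levels L hL (avgClosed_unitaryUnits d L) j U' hUG hα hα3 hα4 hpdev) S (fun _ => (1 : ℂ))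
                (fun s => bump s.1 s.2 (A s.1 s.2)) 0 j le_rfl c.1 c.2,
              linCovIter_zero_fun, Pi.zero_apply, Pi.zero_apply, zero_add]
        _ = ∑ b ∈ S, col c b (A b.1 b.2) := Finset.sum_congr rfl fun b _ => by
            rw [one_smul]; exact (htr _).symm
  -- the summand as a function of the level-`j` bond, at a fixed unit bond `b`
  set f : (Site d × Fin d) → (Site d × Fin d) → ℝ := fun b c => tauForm τ (B c.1 c.2) (col c b (A b.1 b.2)) with hf
  have hf0 : ∀ b c, c ∉ T → f b c = 0 := by
    intro b c hc; simp only [hf, hB c hc, map_zero, LinearMap.zero_apply]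
  -- (b) LHS, bond by bond: the transposed entries pair to `f` (class bonds: `tauForm_entryT`; others: both sides vanish)
  have hLHS : ∀ b ∈ S, tauForm τ (linCovIterT τ L U₀ j B b.1 b.2) (A b.1 b.2) =
      ∑ p : Fin d × Fin 2, f b (winBase L j b.1 p.1 p.2, p.1) := by
    intro b _
    unfold linCovIterT
    rw [map_sum, LinearMap.sum_apply, Fintype.sum_prod_type]
    refine Finset.sum_congr rfl fun κ _ => ?_
    rw [map_sum, LinearMap.sum_apply]
    refine Finset.sum_congr rfl fun t _ => ?_
    by_cases hc : (winBase L j b.1 κ t, κ) ∈ T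
    · obtain ⟨hadd', hsmul', -, -⟩ := hclass _ hc
      exact tauForm_entryT τ hτp (fun X X' => hadd' b X X') (fun r X => hsmul' b r X) _ _
    · rw [hf0 b _ hc, hB _ hc, entryT_zero, map_zero, LinearMap.zero_apply]
  -- (c) the window sum equals the sum over `T`: both are the sum of `f b` over `T ∩ window(b)`
  have hwin : ∀ b ∈ S, ∑ p : Fin d × Fin 2, f b (winBase L j b.1 p.1 p.2, p.1) = ∑ c ∈ T, f b c := by
    intro b _
    set W : Finset (Site d × Fin d) := Finset.univ.image (fun p : Fin d × Fin 2 => (winBase L j b.1 p.1 p.2, p.1)) with hW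
    have h1 : ∑ p : Fin d × Fin 2, f b (winBase L j b.1 p.1 p.2, p.1) = ∑ c ∈ W, f b c := by
      rw [hW, Finset.sum_image (fun p _ q _ h => winBase_injective L j b.1 h)]
    rw [h1]
    -- terms of `W` outside `T` vanish; terms of `T` outside `W` vanish by locality
    have h2 : ∑ c ∈ W, f b c = ∑ c ∈ W.filter (· ∈ T), f b c := by
      rw [Finset.sum_filter]
      refine Finset.sum_congr rfl fun c _ => ?_
      split_ifs with hc
      · rfl
      · exact hf0 b c hc
    have h3 : ∑ c ∈ T, f b c = ∑ c ∈ T.filter (· ∈ W), f b c := by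
      rw [Finset.sum_filter]
      refine Finset.sum_congr rfl fun c hc => ?_
      split_ifs with hcW
      · rfl
      · -- `c ∉ window(b)` ⇒ `b.1 ∉ box(c)` ⇒ the column vanishes
        have hnot : ¬ BondIn (loK L j c.1) (bondHiK L j c.1 c.2) b.1 b.2 := by
          intro hbin
          obtain ⟨t, ht⟩ := eq_winBase_of_inBox hL1 j hbin.1
          exact hcW (by rw [hW, Finset.mem_image]; exact ⟨(c.2, t), Finset.mem_univ _, by rw [← ht]⟩)
        obtain ⟨-, -, hloc, -⟩ := hclass c hc
        simp only [hf, hloc b _ hnot, map_zero]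
    rw [h2, h3]
    refine Finset.sum_congr (Finset.ext fun c => ?_) fun _ _ => rfl
    simp only [Finset.mem_filter]
    exact and_comm
  -- (d) RHS, bond by bond: additivity over the support of `A`
  have hRHS : ∀ c ∈ T, tauForm τ (B c.1 c.2) (linCovIter L U₀ A j c.1 c.2) = ∑ b ∈ S, f b c := by
    intro c hc
    obtain ⟨-, -, -, hsum⟩ := hclass c hc
    rw [hsum, map_sum]
  -- assemble
  calc ∑ b ∈ S, tauForm τ (linCovIterT τ L U₀ j B b.1 b.2) (A b.1 b.2)
      = ∑ b ∈ S, ∑ c ∈ T, f b c := Finset.sum_congr rfl fun b hb => by rw [hLHS b hb, hwin b hb]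
    _ = ∑ c ∈ T, ∑ b ∈ S, f b c := Finset.sum_comm
    _ = ∑ c ∈ T, tauForm τ (B c.1 c.2) (linCovIter L U₀ A j c.1 c.2) := Finset.sum_congr rfl fun c hc => (hRHS c hc).symm

end Pairing



/-! ## §3 EDITION P — the letter and its binder at PRINT'S box law «box ⊂ Ω_{j−1}» (crossing bonds of (1.31)) -/

section EditionP

open B7Prop1Explicit (e)
open B7Prop1Local (InBox loK bondHiK)
open B7Prop2Explicit (unitaryUnits)
open B7Prop5Flat (BondIn bump)
open B7Prop4GeneralLevels (linCovIter)
open B7Prop5GeneralLevels (thetaGen)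
open B8Ineq132 (InAk BondTouches PlaqTouches plaqF)
open B8Eq140Level (SideTouches sideTouches_of_bondTouches)
open B8Eq146AExpansion (iEta norm_iEta_le)
open B8Eq155JBound (wsup wsup_le le_wsup wsup_nonneg)
open B8ScaledSupNorm (msup Bdd msup_nonneg norm_le_of_msup_le)
open B8LeafModelZd (ZdIdx)
open B9SupplySockB9P3ZdLetters (OpsZd)
open B9SupplySockB9P3ZdLettersOmega (OnDom)
open B9SupplySockB9P3ZdAt (AvgAt)
open B9SupplySockB9P3ZdGammaUniv (AvgAtP avgAtP_self)

variable (τ : 𝔸 →ₗ[ℂ] ℂ) [FiniteDimensional ℝ 𝔸] (L : ℕ)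

omit [FiniteDimensional ℝ 𝔸] in
/-- **THE CLASS (1.7) READ ONE LEVEL UP**: `|U(∂p) − 1| < αL^{−2(j−1)} = αL²·L^{−2j}` for the plaquettes touching `Ω_{j−1}` — the regularity print has on
the box of a CROSSING bond of `Λ_j` (box `⊂ Ω_{j−1}`, (1.31)); at `j = 0` the threshold only grows (`L ≥ 1`). [cite: Balaban1985RegularSpaces, (1.7) p.77, (1.31) p.82] -/
theorem reg17_shift {L : ℕ} (hL : 1 ≤ L) {m : ℕ} {Ω : ℕ → Set (Site d)} {α : ℝ} {U₀ : Site d → Fin d → 𝔸ˣ}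
    (h : Reg17 L m Ω α U₀) : Reg17 L m (fun j => Ω (j - 1)) (α * (L : ℝ) ^ 2) U₀ := by
  intro j hj x μ ν hμν hp
  have hL' : (1 : ℝ) ≤ L := by exact_mod_cast hL
  have hL0 : (0 : ℝ) < L := by linarith
  have h1 := h (j - 1) (le_trans (Nat.sub_le j 1) hj) x μ ν hμν hp
  have hαpos : 0 < α := by
    by_contra hα
    have hα' : α ≤ 0 := not_lt.1 hα
    exact absurd (h1.trans_le (mul_nonpos_of_nonpos_of_nonneg hα' (by positivity))) (not_lt.2 (norm_nonneg _))
  refine h1.trans_le ?_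
  rcases Nat.eq_zero_or_pos j with rfl | hjpos
  · have h2 : (1 : ℝ) ≤ (L : ℝ) ^ 2 := one_le_pow₀ hL'
    simp only [Nat.zero_sub, pow_zero, inv_one, one_pow, mul_one]
    calc α = α * 1 := (mul_one α).symm
      _ ≤ α * (L : ℝ) ^ 2 := mul_le_mul_of_nonneg_left h2 hαpos.le
  · have hj1 : j - 1 + 1 = j := Nat.sub_add_cancel hjpos
    have hLj : (L : ℝ) ^ j = (L : ℝ) ^ (j - 1) * L := by rw [← pow_succ, hj1]
    have hP : (0 : ℝ) < (L : ℝ) ^ (j - 1) := by positivity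
    have key : α * (L : ℝ) ^ 2 * ((((L : ℝ) ^ (j - 1) * L)⁻¹) ^ 2) = α * (((L : ℝ) ^ (j - 1))⁻¹) ^ 2 := by
      field_simp
    rw [hLj, key]

open Classical in
/-- ★★ **THE GENUINE AVERAGING LETTER AT PRINT'S BOX LAW** — `QQZd` VERBATIM with the regime window `α_Q(d,L)∕L²` (the class (1.7) at that window gives
window `α_Q` on the boxes `⊂ Ω_{j−1}` of ALL class bonds, crossing ones included): `(Q*aQ A)(b) = Σ_{j≤m} w_j·(Q_jᵀ(𝟙_{Λ_j}LʲηQ_jA))(b)` on the class,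
`0` off it. [cite: Balaban1985BackgroundPropagators, (3.16) p.393, (3.26) p.395; Balaban1985RegularSpaces, (1.56), (1.58) p.86, (1.7) p.77, (1.31) p.82] -/
def QQZdP (ΛbP : ℕ → ℕ → Set (Site d × Fin d)) (i : ZdIdx d L) (m : ℕ) (U₀ : Site d → Fin d → 𝔸ˣ) (A : Site d → Fin d → 𝔸) :
    Site d → Fin d → 𝔸 :=
  fun y μ => if Reg17 L m i.Ω (alphaQ d L / (L : ℝ) ^ 2) U₀ then
      ∑ j ∈ Finset.range (m + 1), (wQ (d := d) L i.η j) • linCovIterT τ L U₀ j (clsField L ΛbP i.η m j U₀ A) y μ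
    else 0

/-- **THE LETTER FAMILY WITH THE GENUINE `Q*aQ`, EDITION P**: `ops₀` with `QQ := QQZdP`. [cite: Balaban1985BackgroundPropagators, (3.26) p.395, (3.16) p.393] -/
def withQQP (ΛbP : ℕ → ℕ → Set (Site d × Fin d)) (ops₀ : ℝ → ZdIdx d L → ℕ → OpsZd d 𝔸) :
    ℝ → ZdIdx d L → ℕ → OpsZd d 𝔸 :=
  fun M i m => { ops₀ M i m with QQ := QQZdP τ L ΛbP i m }

/-- the replaced field, unfolded. [cite: Balaban1985BackgroundPropagators, (3.16) p.393 (bookkeeping)] -/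
@[simp] theorem withQQP_QQ (ΛbP : ℕ → ℕ → Set (Site d × Fin d)) (ops₀ : ℝ → ZdIdx d L → ℕ → OpsZd d 𝔸) (M : ℝ) (i : ZdIdx d L) (m : ℕ) :
    (withQQP τ L ΛbP ops₀ M i m).QQ = QQZdP τ L ΛbP i m := rfl

/-- the untouched fields. [cite: Balaban1985BackgroundPropagators, (3.26) p.395 (bookkeeping)] -/
@[simp] theorem withQQP_Gop (ΛbP : ℕ → ℕ → Set (Site d × Fin d)) (ops₀ : ℝ → ZdIdx d L → ℕ → OpsZd d 𝔸) (M : ℝ) (i : ZdIdx d L) (m : ℕ) :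
    (withQQP τ L ΛbP ops₀ M i m).Gop = (ops₀ M i m).Gop := rfl

/-- the untouched fields. [cite: Balaban1985BackgroundPropagators, (3.26) p.395 (bookkeeping)] -/
@[simp] theorem withQQP_Dp (ΛbP : ℕ → ℕ → Set (Site d × Fin d)) (ops₀ : ℝ → ZdIdx d L → ℕ → OpsZd d 𝔸) (M : ℝ) (i : ZdIdx d L) (m : ℕ) :
    (withQQP τ L ΛbP ops₀ M i m).Dp = (ops₀ M i m).Dp := rfl

/-- the untouched fields. [cite: Balaban1985BackgroundPropagators, (3.26) p.395 (bookkeeping)] -/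
@[simp] theorem withQQP_DRDs (ΛbP : ℕ → ℕ → Set (Site d × Fin d)) (ops₀ : ℝ → ZdIdx d L → ℕ → OpsZd d 𝔸) (M : ℝ) (i : ZdIdx d L) (m : ℕ) :
    (withQQP τ L ΛbP ops₀ M i m).DRDs = (ops₀ M i m).DRDs := rfl

/-- on the class the letter is the genuine sum. [cite: Balaban1985BackgroundPropagators, (3.16) p.393] -/
theorem QQZdP_of_reg17 {ΛbP : ℕ → ℕ → Set (Site d × Fin d)} {i : ZdIdx d L} {m : ℕ} {U₀ : Site d → Fin d → 𝔸ˣ}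
    (h : Reg17 L m i.Ω (alphaQ d L / (L : ℝ) ^ 2) U₀) (A : Site d → Fin d → 𝔸) (y : Site d) (μ : Fin d) :
    QQZdP τ L ΛbP i m U₀ A y μ =
      ∑ j ∈ Finset.range (m + 1), (wQ (d := d) L i.η j) • linCovIterT τ L U₀ j (clsField L ΛbP i.η m j U₀ A) y μ := by
  simp [QQZdP, h]

/-- off the class the letter is `0`. [cite: Balaban1985Averaging, Prop. 3 p.36 (the averaging is defined for regular backgrounds)] -/
theorem QQZdP_of_not_reg17 {ΛbP : ℕ → ℕ → Set (Site d × Fin d)} {i : ZdIdx d L} {m : ℕ} {U₀ : Site d → Fin d → 𝔸ˣ}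
    (h : ¬ Reg17 L m i.Ω (alphaQ d L / (L : ℝ) ^ 2) U₀) (A : Site d → Fin d → 𝔸) (y : Site d) (μ : Fin d) :
    QQZdP τ L ΛbP i m U₀ A y μ = 0 := by
  simp [QQZdP, h]

/-- **THE EDITION-P LETTER IS PRINT'S AT EVERY SOCKET DATUM** with `α₀ ≤ α_Q(d,L)∕L²`. [cite: Balaban1985RegularSpaces, (1.7) p.77, (1.33)–(1.35) p.82] -/
theorem QQZdP_of_inAk {ΛbP : ℕ → ℕ → Set (Site d × Fin d)} {i : ZdIdx d L} {m : ℕ} (hm : m ≤ i.k) {α₀ : ℝ}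
    (hα₀ : α₀ ≤ alphaQ d L / (L : ℝ) ^ 2) {U₀ : Site d → Fin d → 𝔸ˣ} (hU₀ : InAk L i.k i.η α₀ i.Ω U₀)
    (A : Site d → Fin d → 𝔸) (y : Site d) (μ : Fin d) :
    QQZdP τ L ΛbP i m U₀ A y μ =
      ∑ j ∈ Finset.range (m + 1), (wQ (d := d) L i.η j) • linCovIterT τ L U₀ j (clsField L ΛbP i.η m j U₀ A) y μ :=
  QQZdP_of_reg17 τ L (reg17_mono hα₀ (reg17_of_inAk hU₀ hm)) A y μ

omit [FiniteDimensional ℝ 𝔸] in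
/-- **THE CLASS LAW, EDITION P** (print's (1.31)∕[B6] (2.2)): every site `y` of the box of a level-`j` class bond lies in `Ω_{j−1}` (inner AND crossing bonds;
`B8TowerBondsPrinted.towerBondsP_box_subset_pred`), and a unit bond at `y` touches `Ω_i` only for `i ≤ j + s` (the collars).  DISPLAYED.
[cite: Balaban1985RegularSpaces, (1.5) p.77, (1.28)–(1.31) pp.81–82; Balaban1984PropagatorsII, (2.1)–(2.3) p.224] -/
def LevelSepPP (L m : ℕ) (Ω : ℕ → Set (Site d)) (ΛbP : ℕ → ℕ → Set (Site d × Fin d)) (s : ℕ) : Prop :=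
  ∀ j, j ≤ m → ∀ c ∈ ΛbP m j, ∀ y, InBox (loK L j c.1) (bondHiK L j c.1 c.2) y →
    y ∈ Ω (j - 1) ∧ ∀ i', i' ≤ m → ∀ μ : Fin d, BondTouches (Ω i') y μ → i' ≤ j + s

omit [FiniteDimensional ℝ 𝔸] in
/-- v1.0's law (boxes in `Ω_j`) implies edition P's (boxes in `Ω_{j−1} ⊇ Ω_j`) for a nested `Ω`. [cite: Balaban1985RegularSpaces, (1.3) p.77 (nesting)] -/
theorem levelSepPP_of_levelSepP {L m : ℕ} {Ω : ℕ → Set (Site d)} (hΩ : ∀ j, Ω (j + 1) ⊆ Ω j) {ΛbP : ℕ → ℕ → Set (Site d × Fin d)} {s : ℕ}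
    (h : LevelSepP L m Ω ΛbP s) : LevelSepPP L m Ω ΛbP s := by
  intro j hj c hc y hy
  refine ⟨?_, (h j hj c hc y hy).2⟩
  have hmem := (h j hj c hc y hy).1
  rcases Nat.eq_zero_or_pos j with rfl | hjpos
  · simpa using hmem
  · have hj1 : j - 1 + 1 = j := Nat.sub_add_cancel hjpos
    rw [← hj1] at hmem
    exact hΩ _ hmem

variable [Nontrivial 𝔸]

set_option maxHeartbeats 400000 in
/-- ★★★ **EDITION P — THE AVERAGING BINDER FOR THE GENUINE LETTER AT PRINT'S BOX LAW «box ⊂ Ω_{j−1}»** ([B8] (1.31): the CROSSING bonds of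
`Λ_j` have their box in `Ω_{j−1}` only — `B8TowerBondsPrinted.towerBondsP_box_subset_pred`, dag-n05-c's `cubeLamBP_box_subset_pred`): the same theorem
as `avgAtP_withQQ` for the letter `QQZdP` (regime window `α_Q∕L²`, so that the class (1.7) read one level up, `reg17_shift`, is the window `α_Q` on the
boxes) under the law `LevelSepPP` (box of a level-`j` class bond `⊂ Ω_{j−1}`; separation clause unchanged); same constant `q = qQ d L C_τ β_τ s`.
USE THIS EDITION at print's classes (`towerBondsP`, `cubeLamBP'`); v1.0's `avgAtP_withQQ` is the special case of classes whose boxes lie in `Ω_j`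
(`towerBonds`, `cubeLamB`). [cite: Balaban1985BackgroundPropagators, (3.16) p.393, (3.26)–(3.27) p.395; Balaban1985RegularSpaces, (1.56), (1.58)–(1.59) p.86, (1.7) p.77, (1.31) p.82; Balaban1985Averaging, (147) p.40, Prop. 5 p.42] -/
theorem avgAtP_withQQP (hd : 2 ≤ d) (hL : 2 ≤ L)
    {Cτ : ℝ} (hCτ : ∀ x y : 𝔸, |(τ (star x * y)).re| ≤ Cτ * ‖x‖ * ‖y‖)
    (ΛbP : ℕ → ℕ → Set (Site d × Fin d)) (ops₀ : ℝ → ZdIdx d L → ℕ → OpsZd d 𝔸) (M : ℝ) (i : ZdIdx d L)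
    (m : ℕ) {s : ℕ} (hlaw : LevelSepPP L m i.Ω ΛbP s) :
    AvgAtP L (withQQP τ L ΛbP ops₀) (qQ d L Cτ (betaTau τ) s) ΛbP M i m := by
  classical
  intro U₀ hU₀ A hOn j₀ hj₀ y μ htouch
  have hL1 : 1 ≤ L := le_trans (by norm_num) hL
  have hL0 : (0 : ℝ) < L := by exact_mod_cast (lt_of_lt_of_le (by norm_num) hL)
  have hη := i.hη
  have hCτ0 : 0 ≤ Cτ := by
    have h := hCτ 1 1
    simp only [norm_one, mul_one] at h
    exact (abs_nonneg _).trans h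
  have hβτ := betaTau_nonneg τ
  have hθpos : 0 < 1 + thetaGen d L (alphaQ d L) := by
    have := alphaQ_pos d hL1; unfold thetaGen; positivity
  have hθ0 : 0 ≤ 1 + thetaGen d L (alphaQ d L) := hθpos.le
  -- the right-hand side
  set W := wsup 1 (fun p : {p : ℕ × (Site d × Fin d) // p.1 ≤ m ∧ p.2 ∈ ΛbP m p.1} =>
      linCovIter L U₀ (iEta i.η A) p.1.1 p.1.2.1 p.1.2.2) with hW
  have hW0 : 0 ≤ W := wsup_nonneg zero_le_one _
  have hq0 : 0 ≤ qQ d L Cτ (betaTau τ) s := by unfold qQ; positivity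
  show ((L : ℝ) ^ j₀ * i.η) ^ 3 * ‖QQZdP τ L ΛbP i m U₀ A y μ‖ ≤ qQ d L Cτ (betaTau τ) s * W
  by_cases hreg : Reg17 L m i.Ω (alphaQ d L / (L : ℝ) ^ 2) U₀
  swap
  · rw [QQZdP_of_not_reg17 τ L hreg, norm_zero, mul_zero]; positivity
  rw [QQZdP_of_reg17 τ L hreg]
  -- the shifted reading of the class (1.7): window `α_Q` on the domains `Ω_{j−1}`
  have hreg' : Reg17 L m (fun j => i.Ω (j - 1)) (alphaQ d L) U₀ := by
    have h := reg17_shift hL1 hreg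
    rwa [div_mul_cancel₀ _ (by positivity)] at h
  -- (1) `A ∈ E(Ω₀)` is bounded, hence so is `iηA`
  obtain ⟨β, hβ0, hAβ⟩ : ∃ β : ℝ, 0 ≤ β ∧ ∀ z ν, ‖iEta i.η A z ν‖ ≤ β := by
    set c := msup L m i.η (-(1 : ℝ)) (fun j (b : Site d × Fin d) => SideTouches (i.Ω j) b.1 b.2) (fun b => A b.1 b.2)
      with hc
    have hc0 : 0 ≤ c := msup_nonneg L m hη.le _ _ _
    refine ⟨i.η * (c * (((L : ℝ) ^ 0 * i.η) ^ (-(1 : ℝ)))), by positivity, fun z ν => norm_iEta_le hη.le (fun z ν => ?_) z ν⟩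
    by_cases hb : BondTouches (i.Ω 0) z ν
    · obtain ⟨κ, hκ⟩ := exists_ne_dir hd ν
      exact norm_le_of_msup_le (F := fun b : Site d × Fin d => A b.1 b.2) hL1 hη hOn.2 le_rfl (Nat.zero_le m)
        (i := (z, ν)) (sideTouches_of_bondTouches hκ hb)
    · rw [hOn.1 z ν hb, norm_zero]; positivity
  -- (2) the averaged family over the class bonds is bounded (row sums), so each member is below `W`
  have hbox : ∀ j, j ≤ m → ∀ c ∈ ΛbP m j, ∀ x, InBox (loK L j c.1) (bondHiK L j c.1 c.2) x →
      x ∈ (fun j' => i.Ω (j' - 1)) j :=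
    fun j hj c hc x hx => (hlaw j hj c hc x hx).1
  have hB1 : ∀ j, j ≤ m → ∀ c ∈ ΛbP m j, ‖linCovIter L U₀ (iEta i.η A) j c.1 c.2‖ ≤ W := by
    intro j hj c hc
    have hbd : ∀ p : {p : ℕ × (Site d × Fin d) // p.1 ≤ m ∧ p.2 ∈ ΛbP m p.1},
        1 * ‖linCovIter L U₀ (iEta i.η A) p.1.1 p.1.2.1 p.1.2.2‖ ≤
          2 * d * ((1 + thetaGen d L (alphaQ d L)) * (L : ℝ) ^ m) * β := by
      intro p
      rw [one_mul]
      refine (norm_linCovIter_le_of_reg17 hL (alphaQ_pos d hL1) le_rfl hU₀ hreg' p.2.1 p.1.2.1 p.1.2.2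
        (hbox _ p.2.1 _ p.2.2) _ hβ0 (fun z ν _ => hAβ z ν)).trans ?_
      have hpow : (L : ℝ) ^ p.1.1 ≤ (L : ℝ) ^ m := pow_le_pow_right₀ (by exact_mod_cast hL1) p.2.1
      have hd0 : (0 : ℝ) ≤ d := Nat.cast_nonneg d
      exact mul_le_mul_of_nonneg_right (mul_le_mul_of_nonneg_left (mul_le_mul_of_nonneg_left hpow hθ0) (by positivity)) hβ0
    have h := le_wsup hbd ⟨(j, c), hj, hc⟩
    rwa [one_mul] at h
  -- (3) the level-`j` term
  set C : ℝ := 2 * d * (Cτ * betaTau τ * (1 + thetaGen d L (alphaQ d L))) with hC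
  have hC0 : 0 ≤ C := by positivity
  have hlevel : ∀ j ∈ Finset.range (m + 1),
      ((L : ℝ) ^ j₀ * i.η) ^ 3 * ‖(wQ (d := d) L i.η j) • linCovIterT τ L U₀ j (clsField L ΛbP i.η m j U₀ A) y μ‖ ≤
        C * W * (if j₀ ≤ j + s then ((L : ℝ) ^ 3) ^ s * (((L : ℝ) ^ 3)⁻¹) ^ (j + s - j₀) else 0) := by
    intro j hjm
    rw [Finset.mem_range] at hjm
    have hj : j ≤ m := by omega
    -- the column bound at the window bonds carrying class values
    have hK0 : 0 ≤ (1 + thetaGen d L (alphaQ d L)) * ((L : ℝ) ^ j * (((L : ℝ) ^ j) ^ d)⁻¹) := by positivity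
    have hcol : ∀ (κ : Fin d) (t : Fin 2), clsField L ΛbP i.η m j U₀ A (winBase L j y κ t) κ ≠ 0 →
        ∀ X : 𝔸, ‖linCovIter L U₀ (bump y μ X) j (winBase L j y κ t) κ‖ ≤
          (1 + thetaGen d L (alphaQ d L)) * ((L : ℝ) ^ j * (((L : ℝ) ^ j) ^ d)⁻¹) * ‖X‖ := by
      intro κ t hne X
      have hmem : (winBase L j y κ t, κ) ∈ ΛbP m j := by
        by_contra hn; exact hne (by simp [clsField, hn])
      exact norm_linCovIter_bump_le_of_reg17 hL (alphaQ_pos d hL1) le_rfl hU₀ hreg' hj _ κ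
        (hbox j hj _ hmem) y μ X
    have hT := norm_linCovIterT_le τ hCτ L U₀ j (clsField L ΛbP i.η m j U₀ A) y μ hK0 hcol
    -- the class values are below `W`, and vanish off the class
    have hval : ∀ (κ : Fin d) (t : Fin 2), ‖clsField L ΛbP i.η m j U₀ A (winBase L j y κ t) κ‖ ≤
        if (winBase L j y κ t, κ) ∈ ΛbP m j then W else 0 := by
      intro κ t
      unfold clsField
      split_ifs with hmem
      · rw [norm_smul, norm_neg, Complex.norm_I, one_mul]
        exact hB1 j hj _ hmem
      · rw [norm_zero]
    by_cases hP : ∃ (κ : Fin d) (t : Fin 2), (winBase L j y κ t, κ) ∈ ΛbP m j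
    · -- some window bond is a class bond: the class law gives `j₀ ≤ j + s`
      obtain ⟨κ₀, t₀, hmem₀⟩ := hP
      have hsep : j₀ ≤ j + s := (hlaw j hj _ hmem₀ y (inBox_winBase hL1 j y κ₀ t₀)).2 j₀ hj₀ μ htouch
      rw [if_pos hsep]
      have hsumW : ∑ κ : Fin d, ∑ t : Fin 2, ‖clsField L ΛbP i.η m j U₀ A (winBase L j y κ t) κ‖ ≤ 2 * d * W := by
        calc ∑ κ : Fin d, ∑ t : Fin 2, ‖clsField L ΛbP i.η m j U₀ A (winBase L j y κ t) κ‖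
            ≤ ∑ κ : Fin d, ∑ t : Fin 2, W :=
              Finset.sum_le_sum fun κ _ => Finset.sum_le_sum fun t _ => (hval κ t).trans (by split_ifs <;> linarith)
          _ = 2 * d * W := by simp [Finset.sum_const, Finset.card_univ, Fintype.card_fin]; ring
      -- weights: `(L^{j₀}η)³ · w_j · K_j = L^{3(j₀ − j)} · (1+θ)` and `L^{3(j₀−j)} = (L³)^s (L⁻³)^{j+s−j₀}`
      have hLj : (0 : ℝ) < (L : ℝ) ^ j := by positivity
      have hwt : ((L : ℝ) ^ j₀ * i.η) ^ 3 * (wQ (d := d) L i.η j *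
          ((1 + thetaGen d L (alphaQ d L)) * ((L : ℝ) ^ j * (((L : ℝ) ^ j) ^ d)⁻¹))) =
            (1 + thetaGen d L (alphaQ d L)) * (((L : ℝ) ^ 3) ^ s * (((L : ℝ) ^ 3)⁻¹) ^ (j + s - j₀)) := by
        obtain ⟨n, hn⟩ : ∃ n, n = j + s - j₀ := ⟨_, rfl⟩
        have hn' : j₀ + n = s + j := by omega
        rw [← hn]
        have hkey : ((L : ℝ) ^ 3) ^ j₀ * ((L : ℝ) ^ 3) ^ n = ((L : ℝ) ^ 3) ^ s * ((L : ℝ) ^ 3) ^ j := by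
          rw [← pow_add, ← pow_add, hn']
        have hη0 : i.η ≠ 0 := hη.ne'
        have h1 : ((L : ℝ) ^ j₀ * i.η) ^ 3 * ((((L : ℝ) ^ j * i.η) ^ 3)⁻¹) = ((L : ℝ) ^ 3) ^ j₀ * (((L : ℝ) ^ 3) ^ j)⁻¹ := by
          field_simp
          ring
        have h2 : (((L : ℝ) ^ j) ^ d * ((L : ℝ) ^ j)⁻¹) * ((L : ℝ) ^ j * (((L : ℝ) ^ j) ^ d)⁻¹) = 1 := by
          field_simp
        calc ((L : ℝ) ^ j₀ * i.η) ^ 3 * (wQ (d := d) L i.η j *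
              ((1 + thetaGen d L (alphaQ d L)) * ((L : ℝ) ^ j * (((L : ℝ) ^ j) ^ d)⁻¹)))
            = (1 + thetaGen d L (alphaQ d L)) * (((L : ℝ) ^ j₀ * i.η) ^ 3 * ((((L : ℝ) ^ j * i.η) ^ 3)⁻¹)) *
                ((((L : ℝ) ^ j) ^ d * ((L : ℝ) ^ j)⁻¹) * ((L : ℝ) ^ j * (((L : ℝ) ^ j) ^ d)⁻¹)) := by
              unfold wQ; ring
          _ = (1 + thetaGen d L (alphaQ d L)) * (((L : ℝ) ^ 3) ^ j₀ * (((L : ℝ) ^ 3) ^ j)⁻¹) := by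
              rw [h1, h2, mul_one]
          _ = (1 + thetaGen d L (alphaQ d L)) * (((L : ℝ) ^ 3) ^ s * (((L : ℝ) ^ 3)⁻¹) ^ n) := by
              rw [inv_pow]
              congr 1
              rw [← div_eq_mul_inv, ← div_eq_mul_inv, div_eq_div_iff (by positivity) (by positivity), hkey]
      calc ((L : ℝ) ^ j₀ * i.η) ^ 3 * ‖(wQ (d := d) L i.η j) • linCovIterT τ L U₀ j (clsField L ΛbP i.η m j U₀ A) y μ‖
          = ((L : ℝ) ^ j₀ * i.η) ^ 3 * (wQ (d := d) L i.η j * ‖linCovIterT τ L U₀ j (clsField L ΛbP i.η m j U₀ A) y μ‖) := by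
            rw [norm_smul, Real.norm_of_nonneg (wQ_nonneg L hη.le j)]
        _ ≤ ((L : ℝ) ^ j₀ * i.η) ^ 3 * (wQ (d := d) L i.η j *
              (Cτ * betaTau τ * ((1 + thetaGen d L (alphaQ d L)) * ((L : ℝ) ^ j * (((L : ℝ) ^ j) ^ d)⁻¹)) * (2 * d * W))) := by
            refine mul_le_mul_of_nonneg_left (mul_le_mul_of_nonneg_left (hT.trans ?_) (wQ_nonneg L hη.le j)) (by positivity)
            exact mul_le_mul_of_nonneg_left hsumW (by positivity)
        _ = C * W * (((L : ℝ) ^ 3) ^ s * (((L : ℝ) ^ 3)⁻¹) ^ (j + s - j₀)) := by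
            rw [hC]
            linear_combination (Cτ * betaTau τ * (2 * d * W)) * hwt
    · -- no window bond is a class bond: the level-`j` term vanishes
      simp only [not_exists] at hP
      have hzero : ∑ κ : Fin d, ∑ t : Fin 2, ‖clsField L ΛbP i.η m j U₀ A (winBase L j y κ t) κ‖ = 0 := by
        refine Finset.sum_eq_zero fun κ _ => Finset.sum_eq_zero fun t _ => ?_
        have h := hval κ t
        rw [if_neg (hP κ t)] at h
        exact le_antisymm h (norm_nonneg _)
      rw [hzero, mul_zero] at hT
      have hT0 : linCovIterT τ L U₀ j (clsField L ΛbP i.η m j U₀ A) y μ = 0 := norm_le_zero_iff.1 hT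
      rw [hT0, smul_zero, norm_zero, mul_zero]
      split_ifs <;> positivity
  -- (4) sum the levels
  calc ((L : ℝ) ^ j₀ * i.η) ^ 3 *
        ‖∑ j ∈ Finset.range (m + 1), (wQ (d := d) L i.η j) • linCovIterT τ L U₀ j (clsField L ΛbP i.η m j U₀ A) y μ‖
      ≤ ((L : ℝ) ^ j₀ * i.η) ^ 3 *
          ∑ j ∈ Finset.range (m + 1), ‖(wQ (d := d) L i.η j) • linCovIterT τ L U₀ j (clsField L ΛbP i.η m j U₀ A) y μ‖ :=
        mul_le_mul_of_nonneg_left (norm_sum_le _ _) (by positivity)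
    _ = ∑ j ∈ Finset.range (m + 1),
          ((L : ℝ) ^ j₀ * i.η) ^ 3 * ‖(wQ (d := d) L i.η j) • linCovIterT τ L U₀ j (clsField L ΛbP i.η m j U₀ A) y μ‖ := by
        rw [Finset.mul_sum]
    _ ≤ ∑ j ∈ Finset.range (m + 1),
          C * W * (if j₀ ≤ j + s then ((L : ℝ) ^ 3) ^ s * (((L : ℝ) ^ 3)⁻¹) ^ (j + s - j₀) else 0) := Finset.sum_le_sum hlevel
    _ = C * W * ∑ j ∈ Finset.range (m + 1),
          (if j₀ ≤ j + s then ((L : ℝ) ^ 3) ^ s * (((L : ℝ) ^ 3)⁻¹) ^ (j + s - j₀) else 0) := by rw [Finset.mul_sum]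
    _ ≤ C * W * (2 * ((L : ℝ) ^ 3) ^ s) := mul_le_mul_of_nonneg_left (level_sum_le hL m j₀ s) (by positivity)
    _ = qQ d L Cτ (betaTau τ) s * W := by rw [hC, qQ]; ring


/-- ★★ **EDITION P AT THE MEMBER'S OWN CLASS**: at `ΛbP := i.Λb` the above IS `B9SupplySockB9P3ZdAt.AvgAt` for the edition-P letter.
[cite: Balaban1985BackgroundPropagators, (3.16) p.393; Balaban1985RegularSpaces, (1.56), (1.58) p.86] -/
theorem avgAt_withQQP (hd : 2 ≤ d) (hL : 2 ≤ L)
    {Cτ : ℝ} (hCτ : ∀ x y : 𝔸, |(τ (star x * y)).re| ≤ Cτ * ‖x‖ * ‖y‖)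
    (ops₀ : ℝ → ZdIdx d L → ℕ → OpsZd d 𝔸) (M : ℝ) (i : ZdIdx d L)
    (m : ℕ) {s : ℕ} (hlaw : LevelSepPP L m i.Ω i.Λb s) :
    AvgAt L (withQQP τ L i.Λb ops₀) (qQ d L Cτ (betaTau τ) s) M i m :=
  (avgAtP_self L _ _ M i m).1 (avgAtP_withQQP τ L hd hL hCτ i.Λb ops₀ M i m hlaw)

/-- ★ **A6 FOR EDITION P at the abelian fibre** (`𝔸 = ℂ`, `τ = id`). [cite: Balaban1985BackgroundPropagators, (3.16) p.393; Balaban1985RegularSpaces, (1.56), (1.58) p.86] -/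
theorem avgAtP_withQQP_complex (hd : 2 ≤ d) {L : ℕ} (hL : 2 ≤ L) (ΛbP : ℕ → ℕ → Set (Site d × Fin d))
    (ops₀ : ℝ → ZdIdx d L → ℕ → OpsZd d ℂ) (M : ℝ) (i : ZdIdx d L) (m : ℕ) {s : ℕ} (hlaw : LevelSepPP L m i.Ω ΛbP s) :
    AvgAtP L (withQQP (LinearMap.id : ℂ →ₗ[ℂ] ℂ) L ΛbP ops₀) (qQ d L 1 (betaTau (LinearMap.id : ℂ →ₗ[ℂ] ℂ)) s) ΛbP M i m :=
  avgAtP_withQQP (LinearMap.id : ℂ →ₗ[ℂ] ℂ) L hd hL abs_re_star_mul_le_complex ΛbP ops₀ M i m hlaw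

end EditionP


/-! ## §4 EDITION P in the γ currency: `AvgAtγ` (the cube road's binder, level-0 crossing bonds of `Ω₀` in `|B₁|`) for the same letter -/

section Gamma

open B7Prop1Explicit (e)
open B7Prop1Local (InBox loK bondHiK)
open B7Prop2Explicit (unitaryUnits)
open B7Prop5Flat (BondIn bump)
open B7Prop4GeneralLevels (linCovIter linCovIter_zero)
open B7Prop5GeneralLevels (thetaGen)
open B8Ineq132 (InAk BondTouches)
open B8Eq140Level (SideTouches sideTouches_of_bondTouches)
open B8Eq146AExpansion (iEta norm_iEta_le)
open B8Eq155JBound (wsup wsup_le le_wsup wsup_nonneg)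
open B8ScaledSupNorm (msup Bdd msup_nonneg norm_le_of_msup_le)
open B8LeafModelZd (ZdIdx)
open B9SupplySockB9P3ZdLetters (OpsZd)
open B9SupplySockB9P3ZdLettersOmega (OnDom)
open B9SupplySockB9P3ZdBeta (CrossB)
open B9SupplySockB9P3ZdGamma (AvgAtγ)
open B9SupplySockB9P3ZdGammaUniv (AvgAtP)

variable (τ : 𝔸 →ₗ[ℂ] ℂ) [FiniteDimensional ℝ 𝔸] (L : ℕ) [Nontrivial 𝔸]

set_option maxHeartbeats 400000 in
/-- ★★ **EDITION P IN THE γ CURRENCY — `AvgAtγ` FOR THE GENUINE LETTER** (the binder of the cube road's γ suppliers `B9SupplySockB9P3ZdGamma.sockB9P3D4γ_at` ∕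
`…GammaInAk.sockB9P3D4γI_at`, whose `|B₁|` also runs over the level-0 crossing bonds of `Ω₀`): under the hypotheses of `avgAtP_withQQP`,
`AvgAtγ L (withQQP τ L ΛbP ops₀) (qQ d L C_τ β_τ s) ΛbP M i m` — off the class the letter is `0`; on it `avgAtP_withQQP` bounds by the `|B₁|` over the class,
which is below the γ-currency `|B₁|` over the LARGER index (class ∪ level-0 crossing bonds) because that larger family is bounded (class bonds: the row sum of
the companion; a level-0 bond reads `iηA` itself, bounded for `A ∈ E(Ω₀)`), so both weighted suprema are attained. [cite: Balaban1985BackgroundPropagators, (3.16) p.393; Balaban1985RegularSpaces, (1.56), (1.58) p.86, (1.31) p.82, p.77] -/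
theorem avgAtγ_withQQP (hd : 2 ≤ d) (hL : 2 ≤ L)
    {Cτ : ℝ} (hCτ : ∀ x y : 𝔸, |(τ (star x * y)).re| ≤ Cτ * ‖x‖ * ‖y‖)
    (ΛbP : ℕ → ℕ → Set (Site d × Fin d)) (ops₀ : ℝ → ZdIdx d L → ℕ → OpsZd d 𝔸) (M : ℝ) (i : ZdIdx d L)
    (m : ℕ) {s : ℕ} (hlaw : LevelSepPP L m i.Ω ΛbP s) :
    AvgAtγ L (withQQP τ L ΛbP ops₀) (qQ d L Cτ (betaTau τ) s) ΛbP M i m := by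
  classical
  intro U₀ hU₀ A hOn j₀ hj₀ y μ htouch
  have hL1 : 1 ≤ L := le_trans (by norm_num) hL
  have hL0 : (0 : ℝ) < L := by exact_mod_cast (lt_of_lt_of_le (by norm_num) hL)
  have hη := i.hη
  have hCτ0 : 0 ≤ Cτ := by
    have h := hCτ 1 1
    simp only [norm_one, mul_one] at h
    exact (abs_nonneg _).trans h
  have hβτ := betaTau_nonneg τ
  have hθpos : 0 < 1 + thetaGen d L (alphaQ d L) := by
    have := alphaQ_pos d hL1; unfold thetaGen; positivity
  have hq0 : 0 ≤ qQ d L Cτ (betaTau τ) s := by unfold qQ; positivity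
  set Wγ := wsup 1 (fun p : {p : ℕ × (Site d × Fin d) // p.1 ≤ m ∧ (p.2 ∈ ΛbP m p.1 ∨ (p.1 = 0 ∧ CrossB (i.Ω 0) p.2))} =>
      linCovIter L U₀ (iEta i.η A) p.1.1 p.1.2.1 p.1.2.2) with hWγ
  have hWγ0 : 0 ≤ Wγ := wsup_nonneg zero_le_one _
  show ((L : ℝ) ^ j₀ * i.η) ^ 3 * ‖QQZdP τ L ΛbP i m U₀ A y μ‖ ≤ qQ d L Cτ (betaTau τ) s * Wγ
  by_cases hreg : Reg17 L m i.Ω (alphaQ d L / (L : ℝ) ^ 2) U₀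
  swap
  · rw [QQZdP_of_not_reg17 τ L hreg, norm_zero, mul_zero]; positivity
  -- on the class: the `AvgAtP` bound, then `|B₁|(class) ≤ |B₁|(class ∪ crossing)`
  have hP := avgAtP_withQQP τ L hd hL hCτ ΛbP ops₀ M i m hlaw U₀ hU₀ A hOn j₀ hj₀ y μ htouch
  rw [withQQP_QQ] at hP
  refine hP.trans (mul_le_mul_of_nonneg_left ?_ hq0)
  -- the larger family is bounded
  have hreg' : Reg17 L m (fun j => i.Ω (j - 1)) (alphaQ d L) U₀ := by
    have h := reg17_shift hL1 hreg
    rwa [div_mul_cancel₀ _ (by positivity)] at h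
  obtain ⟨β, hβ0, hAβ⟩ : ∃ β : ℝ, 0 ≤ β ∧ ∀ z ν, ‖iEta i.η A z ν‖ ≤ β := by
    set c := msup L m i.η (-(1 : ℝ)) (fun j (b : Site d × Fin d) => SideTouches (i.Ω j) b.1 b.2) (fun b => A b.1 b.2)
      with hc
    have hc0 : 0 ≤ c := msup_nonneg L m hη.le _ _ _
    refine ⟨i.η * (c * (((L : ℝ) ^ 0 * i.η) ^ (-(1 : ℝ)))), by positivity, fun z ν => norm_iEta_le hη.le (fun z ν => ?_) z ν⟩
    by_cases hb : BondTouches (i.Ω 0) z ν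
    · obtain ⟨κ, hκ⟩ := exists_ne_dir hd ν
      exact norm_le_of_msup_le (F := fun b : Site d × Fin d => A b.1 b.2) hL1 hη hOn.2 le_rfl (Nat.zero_le m)
        (i := (z, ν)) (sideTouches_of_bondTouches hκ hb)
    · rw [hOn.1 z ν hb, norm_zero]; positivity
  have hbox : ∀ j, j ≤ m → ∀ c ∈ ΛbP m j, ∀ x, InBox (loK L j c.1) (bondHiK L j c.1 c.2) x →
      x ∈ (fun j' => i.Ω (j' - 1)) j :=
    fun j hj c hc x hx => (hlaw j hj c hc x hx).1
  set R : ℝ := β + 2 * d * ((1 + thetaGen d L (alphaQ d L)) * (L : ℝ) ^ m) * β with hR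
  have hd0 : (0 : ℝ) ≤ d := Nat.cast_nonneg d
  have hR1 : β ≤ R := by
    have h := mul_nonneg (mul_nonneg (by positivity : (0 : ℝ) ≤ 2 * d)
      (mul_nonneg hθpos.le (pow_nonneg hL0.le m))) hβ0
    rw [hR]; linarith
  have hbdγ : ∀ p : {p : ℕ × (Site d × Fin d) // p.1 ≤ m ∧ (p.2 ∈ ΛbP m p.1 ∨ (p.1 = 0 ∧ CrossB (i.Ω 0) p.2))},
      1 * ‖linCovIter L U₀ (iEta i.η A) p.1.1 p.1.2.1 p.1.2.2‖ ≤ R := by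
    intro p
    rw [one_mul]
    rcases p.2.2 with hc | ⟨h0, -⟩
    · refine (norm_linCovIter_le_of_reg17 hL (alphaQ_pos d hL1) le_rfl hU₀ hreg' p.2.1 p.1.2.1 p.1.2.2
        (hbox _ p.2.1 _ hc) _ hβ0 (fun z ν _ => hAβ z ν)).trans ?_
      have hpow : (L : ℝ) ^ p.1.1 ≤ (L : ℝ) ^ m := pow_le_pow_right₀ (by exact_mod_cast hL1) p.2.1
      calc 2 * d * ((1 + thetaGen d L (alphaQ d L)) * (L : ℝ) ^ p.1.1) * β
          ≤ 2 * d * ((1 + thetaGen d L (alphaQ d L)) * (L : ℝ) ^ m) * β :=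
            mul_le_mul_of_nonneg_right (mul_le_mul_of_nonneg_left (mul_le_mul_of_nonneg_left hpow hθpos.le) (by positivity)) hβ0
        _ ≤ R := by rw [hR]; linarith
    · have h00 : p.1.1 = 0 := h0
      rw [h00, linCovIter_zero]
      exact (hAβ _ _).trans hR1
  refine wsup_le (fun p => ?_) hWγ0
  exact le_wsup hbdγ ⟨p.1, p.2.1, Or.inl p.2.2⟩

end Gamma

end Literature.MathematicalPhysics.QuantumFieldTheory.Balaban1983to89.B9Eq316AveragingTransposeZdPrinted

end
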